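import Mathlib.Analysis.Distribution.AEEqOfIntegralContDiff
import Literature.Analysis.FluidPDE.SereginZajaczkowski2007L6
import Literature.Analysis.FluidPDE.ChenHouBlowup
import HarnessLib

/-!
# Seregin–Zajaczkowski 2007: Lemma 4.2 split into its two printed halves

G. Seregin, W. Zajaczkowski, *A sufficient condition of regularity for axially symmetric
solutions to the Navier–Stokes equations*, SIAM J. Math. Anal. 39 (2007) 669–685 =
arXiv:math/0702720 (numbers are those of the arXiv version, §4). The sibling file
`SereginZajaczkowski2007L6.lean` vendors Lemma 4.2 as the named fact `OffAxisPoloidalBound`: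

> **Lemma 4.2.** Under assumptions of Proposition 4.1, there exists a function
> `Φ₁ : ℝ₊ × ℝ₊ → ℝ₊`, non-decreasing in each variable, such that
> `sup_{-(7/4)² < t < 0} ∫_{𝒞̃₁} |V^a(x,t)|^q dx ≤ Φ₁(q, 𝒜₂)`, `1 ≤ q < +∞`,
> `V^a = (V_ϱ, V₃)`, `𝒞̃₁ = 𝒞(5/16, 11/4; 7/4)`, `Q̃₁ = 𝒞̃₁ × ]-(7/4)², 0[`.

Its printed proof (arXiv pp. 5–6) has two halves of a different nature, glued by a cut-off
`ψ` ("a non-negative smooth and axially symmetric cut-off function `ψ` vanishes in a neighborhood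
of the parabolic boundary of `Q̃` and is equal to `1` in `Q̃₁`"):

1. **the dynamic half** — the equation (4.5) for `χ = ω_φ` (the angular vorticity), the energy
   identity (4.9) for `χ̃/ϱ`, `χ̃ = χψ`, Ladyzhenskaya's inequality in the variables `(ϱ, x₃)`,
   the estimates (4.10)–(4.13) and Gronwall: "Estimate (4.13) implies
   `‖χ̃‖_{L_{2,∞}(Q̃)} ≤ Φ₃(𝒜₂)`";
2. **the kinematic half** — for the poloidal field `Ṽ = V^a ψ` at a fixed time, the
   divergence and curl identities (4.3), (4.4), (4.6), (4.7) (`div_a Ṽ = -V_ϱψ/ϱ + V^a·∇_aψ`,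
   `curl_a Ṽ = χ̃ + V_ϱψ_{,3} - V₃ψ_{,ϱ}`), whence "`∫∫ |∇_a Ṽ|² dϱ dx₃ ≤ c ∫∫ (|χ̃|² + |V^a|²)
   dϱ dx₃ ≤ Φ₃(𝒜₂)` and thus `∫∫ |Ṽ(x,t)|^q dϱ dx₃ ≤ Φ₄(q, 𝒜₂)` for all `t ∈ ]-2², 0[`" (the
   two-dimensional Sobolev inequality). "Now, (4.2) immediately follows from the latter
   inequality."

Any cut-off with the two quoted properties will do, and the constants `c`, `Φ₃`, `Φ₄` depend on
it. This file fixes the intermediate shell cylinder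
`Q̃½ = 𝒞½ × ]-(15/8)², 0[`, `𝒞½ = 𝒞(9/32, 23/8; 15/8)` (`Q̃₁ ⊂ Q̃½ ⊂ Q̃`, all margins halved) and
vendors the two halves as named facts meeting on `Q̃½`:

* `OffAxisVorticityL2Bound` (half 1, run with a cut-off equal to `1` on `Q̃½`):
  `sup_{-(15/8)² < t < 0} ∫_{𝒞½} |ω_φ(x,t)|² dx ≤ Φ₃(𝒜₂)`;
* `PoloidalLqOfVorticityL2` (half 2, run with a cut-off in the variables `(ϱ, x₃)` supported in
  `𝒞½` and equal to `1` on `𝒞̃₁`, at a fixed time, for a single smooth axially symmetric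
  divergence-free field `u` on `𝒞½`): `∫_{𝒞̃₁} |u^a|^q dx ≤ Φ₄(q, M, E)` whenever
  `∫_{𝒞½} |ω_φ|² dx ≤ M` and `∫_{𝒞½} |u|² dx ≤ E`;

and PROVES Lemma 4.2 from them (`offAxisPoloidalBound_of`), which is the sentence "Now, (4.2)
immediately follows": at each time `t ∈ ]-(7/4)², 0[` the slice `V(·,t)` is smooth, axially
symmetric and divergence free on `𝒞½` (`IsSmoothAxisymmetricSolutionOn.divergence_eq_zero`:
the distributional condition `div V = 0` holds pointwise for the smooth class), half 1 gives
`M = Φ₃(K)`, and `∫_{𝒞½} |V(·,t)|² ≤ 𝒜₂ ≤ K` for EVERY `t` (`forall_setLIntegral_le_of_ae`: the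
essential supremum in `𝒜₂` bounds every slice of a field continuous on `Q̃`, by Fatou's lemma);
so `Φ₁(q, K) = Φ₄(q, Φ₃(K), K)`, non-decreasing in each variable.

## Rendering choices

* As in the sibling files: the assumptions of Prop. 4.1 are the accepted
  `IsSmoothAxisymmetricSolutionOn Q̃ V P`, `𝒜₂` is the accepted `SereginSverak2009.szEnergy V P
  (D_x V)`, the functions `Φ₃`, `Φ₄` are chosen before the solution and fed upper bounds in `ℝ≥0`.
* `ω_φ = angularVorticity (V t) x = ⟪curl V, e_φ⟫` (accepted, `ChenHouBlowup.lean`; the paper's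
  `χ = ω_φ = V_{ϱ,3} - V_{3,ϱ}`, (4.4), is this component in the right-handed frame
  `(e_ϱ, e_φ, e₃)`; only `ω_φ²` enters).
* Half 2 is stated for one vector field `u : ℝ³ → ℝ³` (no time, no equation): `C^∞` at the points
  of `𝒞½` (the class is `C^∞` in `x`), axially symmetric at the points of `𝒞½`, and
  `div u = 0` on `𝒞½`; this is all the printed argument uses ((4.3) is `div V = 0` in
  cylindrical components, (4.4) is the definition of `ω_φ`).
* The intermediate region `Q̃½` is a choice of this file (the paper fixes one unspecified `ψ`);
  it is recorded in the docstrings of both facts.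

## Not here

The discharges of the two halves: half 1 needs, for the accepted class (smooth in `x`, all
spatial derivatives Hölder continuous in space–time, suitable weak solution — no time derivative
is assumed), the classical vorticity equation on `Q̃` (a bootstrap: `∂_t ω = Δω - curl(ω × V)` in
`𝒟'(Q̃)` with continuous right-hand side), then (4.5)–(4.13) and Gronwall; half 2 needs the
two-dimensional `div`–`curl` identity and Sobolev inequality in the meridian half-plane and the
reduction of shell integrals of axially symmetric integrands to it.

## References

* G. Seregin, W. Zajaczkowski, SIAM J. Math. Anal. 39 (2007) 669–685, arXiv:math/0702720, §4:
  Lemma 4.2 and its proof ((4.3)–(4.13), the displays "`‖χ̃‖_{L_{2,∞}(Q̃)} ≤ Φ₃(𝒜₂)`",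
  "`∫∫ |∇_aṼ|² ≤ … ≤ Φ₃(𝒜₂)`", "`∫∫ |Ṽ|^q ≤ Φ₄(q, 𝒜₂)`", "Now, (4.2) immediately follows").
  [`SereginZajaczkowski2007`]
-/

noncomputable section

open MeasureTheory Set Function Filter Topology TopologicalSpace Metric WithLp
open scoped NNReal ENNReal ContDiff InnerProductSpace RealInnerProductSpace

namespace Literature.Analysis.FluidPDE

namespace SereginZajaczkowski2007

open SereginSverak2009

/-- Local notation for physical space `ℝ³ = EuclideanSpace ℝ (Fin 3)`. -/
local notation "ℝ³" => EuclideanSpace ℝ (Fin 3)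

/-! ### The two halves of the proof of Lemma 4.2 as named facts -/

/-- **Seregin–Zajaczkowski 2007, proof of Lemma 4.2, first half (the vorticity bound).** Under
the assumptions of Prop. 4.1 — "`V` and `P` [are] a sufficiently smooth axially symmetric
solution to the Navier–Stokes equations in `Q̃ = 𝒞̃ × ]-2², 0[`, `𝒞̃ = 𝒞(1/4, 3; 2)`", with
`𝒜₂ = sup_{-2²<t<0} ∫_𝒞̃ |V|² dx + ∫_Q̃ (|∇V|² + |V|³ + |P|^{3/2}) dz` — and for a non-negative
smooth axially symmetric cut-off `ψ` vanishing near the parabolic boundary of `Q̃`, the function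
`χ̃ = χψ`, `χ = ω_φ` the angular component of the vorticity, satisfies
"`‖χ̃‖_{L_{2,∞}(Q̃)} ≤ Φ₃(𝒜₂)`" for a non-decreasing `Φ₃` (proof there: the equation (4.5) for
`χ`, (4.8) for `χ̃`, the energy identity (4.9) for `χ̃/ϱ`, Ladyzhenskaya's inequality in the
variables `(ϱ, x₃)`, the estimates (4.10)–(4.13), Gronwall). Rendered (module docstring) with the
cut-off equal to `1` on the intermediate cylinder `Q̃½ = 𝒞(9/32, 23/8; 15/8) × ]-(15/8)², 0[`:
the assumptions are the accepted `IsSmoothAxisymmetricSolutionOn Q̃ V P`, `𝒜₂` is the accepted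
`SereginSverak2009.szEnergy V P (D_x V)`, `Φ₃ : ℝ≥0 → ℝ≥0` is chosen before the solution and fed
an upper bound `K ≥ 𝒜₂`, `ω_φ = angularVorticity (V t) x` (accepted), and the bound
`∫_{𝒞½} |ω_φ(x,t)|² dx ≤ Φ₃(K)` holds for every `t ∈ ]-(15/8)², 0[`.
[cite: SereginZajaczkowski2007, proof of Lemma 4.2 ((4.5)–(4.13) and "‖χ̃‖_{L_{2,∞}(Q̃)} ≤ Φ₃(𝒜₂)")] -/
def OffAxisVorticityL2Bound : Prop :=
  ∃ Φ₃ : ℝ≥0 → ℝ≥0, Monotone Φ₃ ∧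
    ∀ (V : ℝ → ℝ³ → ℝ³) (P : ℝ → ℝ³ → ℝ),
      IsSmoothAxisymmetricSolutionOn (shellCylOpens (1 / 4) 3 2 2) V P →
      ∀ K : ℝ≥0, szEnergy V P (fun t x => fderiv ℝ (V t) x) ≤ K →
        ∀ t ∈ Ioo (-(15 / 8 : ℝ) ^ 2) 0,
          ∫⁻ x in shell (9 / 32) (23 / 8) (15 / 8), ‖angularVorticity (V t) x‖ₑ ^ 2 ≤ Φ₃ K

/-- **Seregin–Zajaczkowski 2007, proof of Lemma 4.2, second half (poloidal `L^q` bounds from the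
vorticity bound).** For the poloidal part `V^a = (V_ϱ, V₃)` of a (sufficiently smooth) axially
symmetric divergence-free field, `div_a V^a = -V_ϱ/ϱ` (4.3) and `V_{ϱ,3} - V_{3,ϱ} = χ = ω_φ`
(4.4); hence for `Ṽ = V^a ψ` with a smooth axially symmetric cut-off `ψ`,
`div_a Ṽ = -V_ϱψ/ϱ + V_ϱψ_{,ϱ} + V₃ψ_{,3}` (4.6), `curl_a Ṽ = χ̃ + V_ϱψ_{,3} - V₃ψ_{,ϱ}` (4.7), and
"According to (4.6) and (4.7), one may conclude
`∫_{-2}^{2}∫_{1/4}^{3} |∇_a Ṽ|² dϱ dx₃ ≤ c ∫_{-2}^{2}∫_{1/4}^{3} (|χ̃|² + |V^a|²) dϱ dx₃ ≤ Φ₃(𝒜₂)`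
and thus `∫_{-2}^{2}∫_{1/4}^{3} |Ṽ(x,t)|^q dϱ dx₃ ≤ Φ₄(q, 𝒜₂)` for all `t ∈ ]-2², 0[`. Now, (4.2)
immediately follows from the latter inequality" (the two-dimensional `div`–`curl` estimate and
Sobolev inequality in the variables `(ϱ, x₃)`, `1 ≤ q < ∞`). Rendered (module docstring) at a
fixed time, for one field `u : ℝ³ → ℝ³` and a cut-off supported in the intermediate shell
`𝒞½ = 𝒞(9/32, 23/8; 15/8)` and equal to `1` on `𝒞̃₁ = 𝒞(5/16, 11/4; 7/4)`: if `u` is `C^∞` at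
the points of `𝒞½`, axially symmetric at the points of `𝒞½` (`u(R_θ x) = R_θ u(x)`) and
divergence free on `𝒞½`, and if `∫_{𝒞½} |ω_φ|² dx ≤ M`, `∫_{𝒞½} |u|² dx ≤ E`
(`ω_φ = angularVorticity u`, accepted), then `∫_{𝒞̃₁} |u^a|^q dx ≤ Φ₄(q, M, E)` for every real
`q ≥ 1`, with `|u^a| = poloidalSpeed u` (accepted) and `Φ₄ : ℝ≥0 → ℝ≥0 → ℝ≥0 → ℝ≥0` chosen
beforehand, non-decreasing in each variable.
[cite: SereginZajaczkowski2007, proof of Lemma 4.2 ((4.3), (4.4), (4.6), (4.7) and "∫∫|Ṽ|^q dϱdx₃ ≤ Φ₄(q,𝒜₂)")] -/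
def PoloidalLqOfVorticityL2 : Prop :=
  ∃ Φ₄ : ℝ≥0 → ℝ≥0 → ℝ≥0 → ℝ≥0,
    (∀ q M, Monotone (Φ₄ q M)) ∧ (∀ q E, Monotone fun M => Φ₄ q M E) ∧
    (∀ M E, Monotone fun q => Φ₄ q M E) ∧
    ∀ u : ℝ³ → ℝ³,
      (∀ x ∈ shell (9 / 32) (23 / 8) (15 / 8), ContDiffAt ℝ ∞ u x) →
      (∀ θ : ℝ, ∀ x ∈ shell (9 / 32) (23 / 8) (15 / 8), u (rotZ θ x) = rotZ θ (u x)) →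
      (∀ x ∈ shell (9 / 32) (23 / 8) (15 / 8), VectorCalculus.divergence u x = 0) →
      ∀ M E : ℝ≥0,
        ∫⁻ x in shell (9 / 32) (23 / 8) (15 / 8), ‖angularVorticity u x‖ₑ ^ 2 ≤ M →
        ∫⁻ x in shell (9 / 32) (23 / 8) (15 / 8), ‖u x‖ₑ ^ 2 ≤ E →
        ∀ q : ℝ≥0, 1 ≤ q →
          ∫⁻ x in shell (5 / 16) (11 / 4) (7 / 4), ‖poloidalSpeed u x‖ₑ ^ (q : ℝ) ≤ Φ₄ q M E

/-! ### Every slice of a continuous field obeys the essential-supremum bound -/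

/-- **From almost every slice to every slice.** If `V` is continuous on `I ×ˢ S` with `I` open,
and `∫_S |V(t,x)|² dx ≤ K` for a.e. `t ∈ I`, then the bound holds for every `t ∈ I`: the good
times are dense in `I`, and along them Fatou's lemma gives
`∫_S |V(t₀,·)|² = ∫_S liminf |V(t,·)|² ≤ liminf ∫_S |V(t,·)|² ≤ K`. [folklore] -/
theorem forall_setLIntegral_le_of_ae {I : Set ℝ} (hI : IsOpen I) {S : Set ℝ³}
    (hS : MeasurableSet S) {V : ℝ → ℝ³ → ℝ³} (hV : ContinuousOn (uncurry V) (I ×ˢ S))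
    {K : ℝ≥0∞} (h : ∀ᵐ t ∂(volume.restrict I), ∫⁻ x in S, ‖V t x‖ₑ ^ 2 ≤ K) :
    ∀ t ∈ I, ∫⁻ x in S, ‖V t x‖ₑ ^ 2 ≤ K := by
  intro t₀ ht₀
  set G : Set ℝ := {t | ∫⁻ x in S, ‖V t x‖ₑ ^ 2 ≤ K} with hG
  -- the good times are dense at `t₀`
  have hnull : volume (Gᶜ ∩ I) = 0 := by
    have h' : volume.restrict I Gᶜ = 0 := by
      rw [← ae_iff.1 h]
      rfl
    rwa [Measure.restrict_apply' hI.measurableSet] at h'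
  have hcl : t₀ ∈ closure (G ∩ I) := by
    rw [_root_.mem_closure_iff]
    intro U hU hUt
    by_contra hem
    rw [not_nonempty_iff_eq_empty] at hem
    have hsub : U ∩ I ⊆ Gᶜ ∩ I := by
      rintro t ⟨htU, htI⟩
      refine ⟨fun htG => ?_, htI⟩
      have : t ∈ U ∩ (G ∩ I) := ⟨htU, htG, htI⟩
      rw [hem] at this
      exact this
    have hpos : 0 < volume (U ∩ I) := (hU.inter hI).measure_pos volume ⟨t₀, hUt, ht₀⟩
    exact hpos.ne' (measure_mono_null hsub hnull)
  haveI hne : (𝓝[G ∩ I] t₀).NeBot := mem_closure_iff_nhdsWithin_neBot.1 hcl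
  -- pointwise convergence of the integrands along the good times
  have hpt : ∀ x ∈ S, Tendsto (fun t => ‖V t x‖ₑ ^ 2) (𝓝[G ∩ I] t₀) (𝓝 (‖V t₀ x‖ₑ ^ 2)) := by
    intro x hx
    have hf : ContinuousWithinAt (fun t : ℝ => ((t, x) : ℝ × ℝ³)) I t₀ :=
      (continuous_id.prodMk continuous_const).continuousWithinAt
    have hc : ContinuousWithinAt (fun t => uncurry V (t, x)) I t₀ :=
      ContinuousWithinAt.comp (f := fun t : ℝ => ((t, x) : ℝ × ℝ³)) (x := t₀)
        (hV (t₀, x) ⟨ht₀, hx⟩) hf fun t ht => ⟨ht, hx⟩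
    have h1 : Tendsto (fun t => V t x) (𝓝[G ∩ I] t₀) (𝓝 (V t₀ x)) :=
      hc.tendsto.mono_left (nhdsWithin_mono _ inter_subset_right)
    exact ((ENNReal.continuous_pow 2).tendsto _).comp ((continuous_enorm.tendsto _).comp h1)
  -- a family measurable for every index: `V` on `I`, `0` elsewhere
  set F : ℝ → ℝ³ → ℝ≥0∞ := fun t x => I.indicator (fun s => (‖V s x‖ₑ ^ 2 : ℝ≥0∞)) t with hF
  have hFI : ∀ t ∈ I, F t = fun x => ‖V t x‖ₑ ^ 2 := fun t ht => by
    funext x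
    simp only [hF, indicator_of_mem ht]
  have hmeas : ∀ t, AEMeasurable (F t) (volume.restrict S) := by
    intro t
    by_cases ht : t ∈ I
    · rw [hFI t ht]
      have hc : ContinuousOn (fun x => V t x) S := fun x hx => by
        have hf : ContinuousWithinAt (fun y : ℝ³ => ((t, y) : ℝ × ℝ³)) S x :=
          (continuous_const.prodMk continuous_id).continuousWithinAt
        exact ContinuousWithinAt.comp (f := fun y : ℝ³ => ((t, y) : ℝ × ℝ³)) (x := x)
          (hV (t, x) ⟨ht, hx⟩) hf fun y hy => ⟨ht, hy⟩
      exact ((hc.aemeasurable hS).enorm.pow_const 2)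
    · have h0 : F t = fun _ => 0 := by
        funext x
        simp only [hF, indicator_of_notMem ht]
      rw [h0]
      exact aemeasurable_const
  have hev : ∀ᶠ t in 𝓝[G ∩ I] t₀, t ∈ G ∩ I := self_mem_nhdsWithin
  have hpt' : ∀ x ∈ S, Tendsto (fun t => F t x) (𝓝[G ∩ I] t₀) (𝓝 (‖V t₀ x‖ₑ ^ 2)) := by
    intro x hx
    refine (hpt x hx).congr' ?_
    filter_upwards [hev] with t ht
    rw [hFI t ht.2]
  -- Fatou along the filter of good times
  calc ∫⁻ x in S, ‖V t₀ x‖ₑ ^ 2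
      = ∫⁻ x in S, liminf (fun t => F t x) (𝓝[G ∩ I] t₀) := by
        refine setLIntegral_congr_fun hS fun x hx => ?_
        exact ((hpt' x hx).liminf_eq).symm
    _ ≤ liminf (fun t => ∫⁻ x in S, F t x) (𝓝[G ∩ I] t₀) := lintegral_liminf_le' hmeas
    _ ≤ K := by
        refine liminf_le_of_frequently_le' (Eventually.frequently ?_)
        filter_upwards [hev] with t ht
        rw [hFI t ht.2]
        exact ht.1

/-- `𝒞̃ = 𝒞(1/4, 3; 2)` is the spatial shell `𝒫²₁(0)` of Seregin–Šverák 2009 over which the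
first term of `𝒜₂ = szEnergy` is integrated. [cite: SereginZajaczkowski2007, Prop. 4.1 (the set 𝒞̃)] -/
theorem outerShellSpace_one_eq : outerShellSpace 1 0 = shell (1 / 4) 3 2 := by
  ext x
  rw [mem_outerShellSpace, mem_shell, sub_zero]
  norm_num

/-- **Every slice obeys the energy bound.** Under the assumptions of Prop. 4.1 and `𝒜₂ ≤ K`,
`∫_𝒞̃ |V(x,t)|² dx ≤ K` for EVERY `t ∈ ]-2², 0[` (not only almost every `t`, as the essential
supremum in `𝒜₂` says): `V` is continuous on `Q̃` (`forall_setLIntegral_le_of_ae`).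
[cite: SereginZajaczkowski2007, Prop. 4.1 (the functional 𝒜₂, "sup_{-2²<t<0}")] -/
theorem IsSmoothAxisymmetricSolutionOn.setLIntegral_sq_le {V : ℝ → ℝ³ → ℝ³} {P : ℝ → ℝ³ → ℝ}
    (hV : IsSmoothAxisymmetricSolutionOn (shellCylOpens (1 / 4) 3 2 2) V P)
    {G : ℝ → ℝ³ → ℝ³ →L[ℝ] ℝ³} {K : ℝ≥0∞} (hK : szEnergy V P G ≤ K) :
    ∀ t ∈ Ioo (-(2 : ℝ) ^ 2) 0, ∫⁻ x in shell (1 / 4) 3 2, ‖V t x‖ₑ ^ 2 ≤ K := by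
  have hae : ∀ᵐ t ∂(volume.restrict (Ioo (-(2 : ℝ) ^ 2) 0)),
      ∫⁻ x in shell (1 / 4) 3 2, ‖V t x‖ₑ ^ 2 ≤ K := by
    rw [← outerShellSpace_one_eq]
    filter_upwards [ENNReal.ae_le_essSup fun s : ℝ =>
      ∫⁻ y in outerShellSpace 1 0, ‖V s y‖ₑ ^ 2] with t ht
    refine ht.trans (le_trans ?_ hK)
    unfold szEnergy
    exact le_add_right (le_add_right le_self_add)
  have hcont : ContinuousOn (uncurry V) (Ioo (-(2 : ℝ) ^ 2) 0 ×ˢ shell (1 / 4) 3 2) := by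
    have h := hV.continuousOn_velocity
    rwa [coe_shellCylOpens, shellCyl_eq_prod] at h
  exact forall_setLIntegral_le_of_ae isOpen_Ioo (isOpen_shell _ _ _).measurableSet hcont hae

/-! ### The smooth class is divergence free pointwise -/

/-- A product `f · g` with `f` continuous, `tsupport f ⊆ W`, `W` open, and `g` continuous on `W`,
is continuous (it vanishes near every point outside `W`); topological-space version of the
sibling file's `continuous_mul_of_tsupport_subset`. [folklore] -/
theorem continuous_mul_of_tsupport_subset' {X : Type*} [TopologicalSpace X] {f g : X → ℝ}
    {W : Set X} (hW : IsOpen W) (hf : Continuous f) (hfW : tsupport f ⊆ W)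
    (hg : ContinuousOn g W) : Continuous fun x => f x * g x := by
  rw [continuous_iff_continuousAt]
  intro x
  by_cases hx : x ∈ W
  · exact hf.continuousAt.mul (hg.continuousAt (hW.mem_nhds hx))
  · have hx' : x ∉ tsupport f := fun h => hx (hfW h)
    have h0 : (fun y => f y * g y) =ᶠ[𝓝 x] fun _ => 0 := by
      filter_upwards [notMem_tsupport_iff_eventuallyEq.1 hx'] with y hy
      rw [hy, Pi.zero_apply, zero_mul]
    exact continuousAt_const.congr h0.symm

/-- **The smooth class is divergence free pointwise.** For `(V, P)` in the class of Prop. 4.1 on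
an open `S` (a distributional solution, so `∫∫_S ⟪V, ∇θ⟫ = 0` for all `θ ∈ C_c^∞(S)`, whose
slices are `C¹` with `D_x V` continuous on `S`), `div V(t, ·)(x) = 0` at every `(t, x) ∈ S`:
integrating by parts slice by slice (the classical gradient is a weak spatial gradient,
`hasWeakSpatialGradientOn_fderiv`) gives `∫∫ θ div V = 0` for all tests, so `div V = 0` a.e. on
`S` (Mathlib's `IsOpen.ae_eq_zero_of_integral_contDiff_smul_eq_zero`), hence everywhere by
continuity. [folklore] -/
theorem IsSmoothAxisymmetricSolutionOn.divergence_eq_zero {S : Opens (ℝ × ℝ³)}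
    {V : ℝ → ℝ³ → ℝ³} {P : ℝ → ℝ³ → ℝ} (h : IsSmoothAxisymmetricSolutionOn S V P)
    {z : ℝ × ℝ³} (hz : z ∈ (S : Set (ℝ × ℝ³))) :
    VectorCalculus.divergence (V z.1) z.2 = 0 := by
  set b : OrthonormalBasis (Fin 3) ℝ ℝ³ := EuclideanSpace.basisFun (Fin 3) ℝ with hb
  -- the divergence as a space–time function, continuous on `S`
  set D : ℝ × ℝ³ → ℝ := fun w => VectorCalculus.divergence (V w.1) w.2 with hD
  have hDeq : ∀ w, D w = ∑ i, ⟪fderiv ℝ (V w.1) w.2 (b i), b i⟫ := fun w => by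
    simp only [hD, divergence_eq_sum_inner_fderiv b]
    exact Finset.sum_congr rfl fun i _ => real_inner_comm _ _
  have hDc : ContinuousOn D (S : Set (ℝ × ℝ³)) := by
    rw [show D = fun w => ∑ i, ⟪fderiv ℝ (V w.1) w.2 (b i), b i⟫ from funext hDeq]
    exact continuousOn_finsetSum _ fun i _ =>
      (h.continuousOn_fderiv.clm_apply continuousOn_const).inner continuousOn_const
  -- the classical spatial gradient is a weak spatial gradient on `S`
  have hG := hasWeakSpatialGradientOn_fderiv h.continuousOn_velocity h.continuousOn_fderiv
    fun w hw => h.differentiableAt hw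
  -- `∫ g D = 0` for every test function `g` on `S`
  have hzero : ∀ g : ℝ × ℝ³ → ℝ, ContDiff ℝ ∞ g → HasCompactSupport g →
      tsupport g ⊆ (S : Set (ℝ × ℝ³)) → ∫ w, g w • D w = 0 := by
    intro g hg hgc hgS
    set φ : ℝ → ℝ³ → ℝ := fun t x => g (t, x) with hφ
    have hφtest : IsSpaceTimeTestOn S φ := ⟨hg, hgc, hgS⟩
    have hgd : Differentiable ℝ g := hg.differentiable (by simp)
    -- slices: `D(φ t)(x) v = Dg(t, x)(0, v)`
    have hslice : ∀ (t : ℝ) (x v : ℝ³), fderiv ℝ (φ t) x v = fderiv ℝ g (t, x) ((0 : ℝ), v) := by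
      intro t x v
      have h1 : HasFDerivAt (fun y : ℝ³ => ((t, y) : ℝ × ℝ³)) (ContinuousLinearMap.inr ℝ ℝ ℝ³) x :=
        hasFDerivAt_prodMk_right t x
      have h2 := ((hgd (t, x)).hasFDerivAt).comp x h1
      rw [show φ t = g ∘ fun y : ℝ³ => ((t, y) : ℝ × ℝ³) from rfl, h2.fderiv]
      rfl
    have hslice0 : ∀ w : ℝ × ℝ³, w ∉ tsupport g → ∀ v : ℝ³, fderiv ℝ (φ w.1) w.2 v = 0 := by
      intro w hw v
      rw [hslice, image_eq_zero_of_notMem_tsupport fun h' => hw (tsupport_fderiv_subset ℝ h'),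
        zero_apply]
    -- the two families of integrands
    set A : Fin 3 → ℝ × ℝ³ → ℝ := fun i w => fderiv ℝ (φ w.1) w.2 (b i) * ⟪V w.1 w.2, b i⟫
      with hA
    set B : Fin 3 → ℝ × ℝ³ → ℝ := fun i w => φ w.1 w.2 * ⟪fderiv ℝ (V w.1) w.2 (b i), b i⟫
      with hB
    have hfc : ∀ i, Continuous fun w : ℝ × ℝ³ => fderiv ℝ (φ w.1) w.2 (b i) := fun i => by
      rw [show (fun w : ℝ × ℝ³ => fderiv ℝ (φ w.1) w.2 (b i)) =
          fun w => fderiv ℝ g w ((0 : ℝ), b i) from funext fun w => hslice w.1 w.2 (b i)]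
      exact (hg.continuous_fderiv (by simp)).clm_apply continuous_const
    have hfs : ∀ i, tsupport (fun w : ℝ × ℝ³ => fderiv ℝ (φ w.1) w.2 (b i)) ⊆ tsupport g :=
      fun i => by
      rw [show (fun w : ℝ × ℝ³ => fderiv ℝ (φ w.1) w.2 (b i)) =
          fun w => fderiv ℝ g w ((0 : ℝ), b i) from funext fun w => hslice w.1 w.2 (b i)]
      exact tsupport_fderiv_apply_subset ℝ _
    have hAc : ∀ i, Continuous (A i) := fun i =>
      continuous_mul_of_tsupport_subset' S.isOpen (hfc i) ((hfs i).trans hgS)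
        (h.continuousOn_velocity.inner continuousOn_const)
    have hBc : ∀ i, Continuous (B i) := fun i =>
      continuous_mul_of_tsupport_subset' S.isOpen hg.continuous hgS
        ((h.continuousOn_fderiv.clm_apply continuousOn_const).inner continuousOn_const)
    have hfcs : ∀ i, HasCompactSupport fun w : ℝ × ℝ³ => fderiv ℝ (φ w.1) w.2 (b i) :=
      fun i => by
      rw [show (fun w : ℝ × ℝ³ => fderiv ℝ (φ w.1) w.2 (b i)) =
          fun w => fderiv ℝ g w ((0 : ℝ), b i) from funext fun w => hslice w.1 w.2 (b i)]
      exact hgc.fderiv_apply (𝕜 := ℝ) _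
    have hAi : ∀ i, Integrable (A i) := fun i =>
      (hAc i).integrable_of_hasCompactSupport (hfcs i).mul_right
    have hBi : ∀ i, Integrable (B i) := fun i =>
      (hBc i).integrable_of_hasCompactSupport hgc.mul_right
    -- (★) integration by parts slice by slice, per direction
    have hstar : ∀ i, ∫ t, ∫ x, A i (t, x) = -∫ t, ∫ x, B i (t, x) := fun i =>
      hG.integral_fderiv_mul_inner_eq φ hφtest (b i) (b i)
    -- (◆) the distributional divergence-free condition
    have hdiamond : ∫ w in (S : Set (ℝ × ℝ³)), ⟪V w.1 w.2, gradient (φ w.1) w.2⟫ = 0 :=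
      h.suitable.distributional.2.2.2.1 φ hφtest
    -- pointwise: `⟪V, ∇φ⟫ = Σ A i`, `g D = Σ B i`
    have hsumA : ∀ w : ℝ × ℝ³, ⟪V w.1 w.2, gradient (φ w.1) w.2⟫ = ∑ i, A i w := by
      intro w
      rw [gradient, real_inner_comm, InnerProductSpace.toDual_symm_apply]
      conv_lhs => rw [← b.sum_repr' (V w.1 w.2)]
      rw [map_sum]
      refine Finset.sum_congr rfl fun i _ => ?_
      rw [map_smul, smul_eq_mul, mul_comm, real_inner_comm]
    have hsumB : ∀ w : ℝ × ℝ³, g w • D w = ∑ i, B i w := by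
      intro w
      rw [hDeq, smul_eq_mul, Finset.mul_sum]
    -- Fubini for each family
    have hFubA : ∀ i, ∫ w, A i w = ∫ t, ∫ x, A i (t, x) := fun i => by
      rw [Measure.volume_eq_prod]
      exact integral_prod (A i) ((Measure.volume_eq_prod (ℝ) (ℝ³)) ▸ hAi i)
    have hFubB : ∀ i, ∫ w, B i w = ∫ t, ∫ x, B i (t, x) := fun i => by
      rw [Measure.volume_eq_prod]
      exact integral_prod (B i) ((Measure.volume_eq_prod (ℝ) (ℝ³)) ▸ hBi i)
    -- assembling
    have hoff : ∀ w, w ∉ (S : Set (ℝ × ℝ³)) → ⟪V w.1 w.2, gradient (φ w.1) w.2⟫ = 0 := by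
      intro w hw
      rw [hsumA]
      refine Finset.sum_eq_zero fun i _ => ?_
      show fderiv ℝ (φ w.1) w.2 (b i) * ⟪V w.1 w.2, b i⟫ = 0
      rw [hslice0 w (fun h' => hw (hgS h')), zero_mul]
    calc ∫ w, g w • D w = ∫ w, ∑ i, B i w := integral_congr_ae (Eventually.of_forall hsumB)
      _ = ∑ i, ∫ w, B i w := integral_finsetSum _ fun i _ => hBi i
      _ = ∑ i, -∫ w, A i w := by
          refine Finset.sum_congr rfl fun i _ => ?_
          rw [hFubB, hFubA, hstar, neg_neg]
      _ = -∫ w, ∑ i, A i w := by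
          rw [Finset.sum_neg_distrib, integral_finsetSum _ fun i _ => hAi i]
      _ = -∫ w : ℝ × ℝ³, ⟪V w.1 w.2, gradient (φ w.1) w.2⟫ := by
          rw [integral_congr_ae (Eventually.of_forall hsumA)]
      _ = -∫ w in (S : Set (ℝ × ℝ³)), ⟪V w.1 w.2, gradient (φ w.1) w.2⟫ := by
          rw [setIntegral_eq_integral_of_forall_compl_eq_zero hoff]
      _ = 0 := by rw [hdiamond, neg_zero]
  -- a.e. zero on `S`, then everywhere by continuity
  have hae : ∀ᵐ w ∂(volume : Measure (ℝ × ℝ³)), w ∈ (S : Set (ℝ × ℝ³)) → D w = 0 :=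
    S.isOpen.ae_eq_zero_of_integral_contDiff_smul_eq_zero
      (hDc.locallyIntegrableOn S.isOpen.measurableSet) hzero
  have hae' : ∀ᵐ w ∂(volume.restrict (S : Set (ℝ × ℝ³))), D w = 0 :=
    (ae_restrict_iff' S.isOpen.measurableSet).2 hae
  have h1 : ∀ w ∈ (S : Set (ℝ × ℝ³)), D w ≤ 0 :=
    forall_le_of_ae_le_of_continuousOn S.isOpen hDc continuousOn_const
      (hae'.mono fun w hw => hw.le)
  have h2 : ∀ w ∈ (S : Set (ℝ × ℝ³)), (0 : ℝ) ≤ D w :=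
    forall_le_of_ae_le_of_continuousOn S.isOpen continuousOn_const hDc
      (hae'.mono fun w hw => hw.ge)
  exact le_antisymm (h1 z hz) (h2 z hz)

/-! ### Proved: Lemma 4.2 from its two halves -/

/-- `𝒞½ = 𝒞(9/32, 23/8; 15/8) ⊆ 𝒞̃ = 𝒞(1/4, 3; 2)`. [cite: SereginZajaczkowski2007, proof of Lemma 4.2 (the cut-off ψ)] -/
theorem shell_half_subset_tilde : shell (9 / 32) (23 / 8) (15 / 8) ⊆ shell (1 / 4) 3 2 := by
  intro x hx
  rw [mem_shell] at hx ⊢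
  exact ⟨⟨by linarith [hx.1.1], by linarith [hx.1.2]⟩, by linarith [hx.2]⟩

/-- **Seregin–Zajaczkowski 2007, Lemma 4.2, proved from the two halves of its proof** ("Now,
(4.2) immediately follows from the latter inequality"): given the assumptions of Prop. 4.1 on
`Q̃` and `𝒜₂ ≤ K`, at each time `t ∈ ]-(7/4)², 0[` the slice `V(·, t)` is `C^∞`, axially
symmetric and divergence free (`IsSmoothAxisymmetricSolutionOn.divergence_eq_zero`) on the
intermediate shell `𝒞½ ⊆ 𝒞̃`; the first half gives `∫_{𝒞½} |ω_φ(·,t)|² ≤ Φ₃(K)`, the energy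
bound gives `∫_{𝒞½} |V(·,t)|² ≤ ∫_𝒞̃ |V(·,t)|² ≤ K` for this (every) `t`
(`IsSmoothAxisymmetricSolutionOn.setLIntegral_sq_le`), and the second half then bounds
`∫_{𝒞̃₁} |V^a(·,t)|^q` by `Φ₄(q, Φ₃(K), K) =: Φ₁(q, K)`, non-decreasing in `q` and in `K`.
[cite: SereginZajaczkowski2007, Lemma 4.2 ((4.2)) and its proof, last sentence] -/
theorem offAxisPoloidalBound_of (hA : OffAxisVorticityL2Bound) (hB : PoloidalLqOfVorticityL2) :
    OffAxisPoloidalBound := by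
  obtain ⟨Φ₃, hΦ₃, hA⟩ := hA
  obtain ⟨Φ₄, hΦ₄E, hΦ₄M, hΦ₄q, hB⟩ := hB
  refine ⟨fun q K => Φ₄ q (Φ₃ K) K, ?_, ?_, ?_⟩
  · intro q K K' hKK'
    exact (hΦ₄M q K (hΦ₃ hKK')).trans (hΦ₄E q (Φ₃ K') hKK')
  · intro K q q' hqq'
    exact hΦ₄q (Φ₃ K) K hqq'
  intro V P hV K hK q hq t ht
  have ht4 : t ∈ Ioo (-(2 : ℝ) ^ 2) 0 := ⟨by linarith [ht.1], ht.2⟩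
  have hthalf : t ∈ Ioo (-(15 / 8 : ℝ) ^ 2) 0 := ⟨by linarith [ht.1], ht.2⟩
  have hmem : ∀ x ∈ shell (9 / 32) (23 / 8) (15 / 8),
      ((t, x) : ℝ × ℝ³) ∈ (shellCylOpens (1 / 4) 3 2 2 : Set (ℝ × ℝ³)) := fun x hx =>
    ⟨ht4, shell_half_subset_tilde hx⟩
  -- the slice at time `t` on the intermediate shell
  have hsmooth : ∀ x ∈ shell (9 / 32) (23 / 8) (15 / 8), ContDiffAt ℝ ∞ (V t) x := fun x hx =>
    hV.contDiffAt (t, x) (hmem x hx)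
  have haxi : ∀ θ : ℝ, ∀ x ∈ shell (9 / 32) (23 / 8) (15 / 8),
      V t (rotZ θ x) = rotZ θ (V t x) := fun θ x hx =>
    hV.axisymmetric θ (t, x) (hmem x hx)
  have hdiv : ∀ x ∈ shell (9 / 32) (23 / 8) (15 / 8), VectorCalculus.divergence (V t) x = 0 :=
    fun x hx => hV.divergence_eq_zero (hmem x hx)
  -- the two inputs of the second half
  have hM := hA V P hV K hK t hthalf
  have hE : ∫⁻ x in shell (9 / 32) (23 / 8) (15 / 8), ‖V t x‖ₑ ^ 2 ≤ K :=
    (lintegral_mono_set shell_half_subset_tilde).trans (hV.setLIntegral_sq_le hK t ht4)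
  exact hB (V t) hsmooth haxi hdiv (Φ₃ K) K hM hE q hq

end SereginZajaczkowski2007

end Literature.Analysis.FluidPDE
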